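import Summits.ResolutionOfSingularities.ResolutionOfSingularities.Theorems.WeightedInvariantWeightedThesisHypersurfaceChoiceT
import Summits.ResolutionOfSingularities.ResolutionOfSingularities.Theorems.WeightedInvariantDatumToEmbeddedAtlasAmbientAssembly
import HarnessLib

/-!
# The ambient charts of the route's graded atlases ARE tower charts (RESHAPE 10, consumer side I)

Route `ResolutionOfSingularities/WeightedInvariant`, crux `Theses.WeightedInvariant.WeightedThesis`
(stmt-ResolutionOfSingularities-0569), line `datum-glued-split`, lead c9, RESHAPE 10.

`DatumToEmbedded.AtlasAmbient.exists_ambientChart` (crux 0572, `…AtlasAmbientAssembly.lean`) builds the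
chart `W' = D(β t^{Dg})` of the cobordant blow-up `B₊` over a graded chart `W a` of `Y`, with its
`ℤʲ⁺¹`-grading, as a term of `AmbientChart`, but its statement forgets WHICH grading it is. Here the same
construction is re-run with the grading EXPOSED: the chart is a `TowerChartStep` over `(W a, 𝒜.piece a)`
(`Theorems/…HypersurfaceChoiceT.lean`: transport `e : Γ(B₊, W') ≃+* L = (⊕ₙ 𝒥ₙ(W a) tⁿ)[1/β t^{Dg}]`,
grading `awayPiece (subalgebraPiece (laurentPiece 𝒜₀) _)` = (old `ℤʲ`-degree, `t`-degree), pinned on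
`t⁻¹ ↦ (0,−1)`, `s ↦ (χ,0)`, `x tⁿ ↦ (χ,n)`).

* `exists_ambientChart_of_chart_towerTyped` — the transport step (verbatim the tree's
  `exists_ambientChart_of_chart`, adapted from `…AtlasAmbientAssembly.lean`, with one more hypothesis — the
  degree `(χ, n)` of `x tⁿ` — and one more conclusion — `TowerChartStep`);
* `exists_ambientChart_towerTyped` — the chart `D(β t^{Dg})` (verbatim the tree's `exists_ambientChart`,
  the extra hypothesis discharged by `mem_subalgebraPiece_of_coe_eq` + `algebraMap_mem_awayPiece`);
* `hyp_exists_ambientChart_towerTyped` (registered stub of the line) — its registered form.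

All proofs are glue on the tree; no definitions, no named facts.
-/

noncomputable section

open scoped LaurentPolynomial
open LaurentPolynomial CategoryTheory CategoryTheory.Limits AlgebraicGeometry TopologicalSpace
open Literature.AlgebraicGeometry.Resolution
open Summit.ResolutionOfSingularities.ResolutionOfSingularities.Theorems

set_option linter.dupNamespace false -- mandated namespace `…Theorems.DatumToEmbedded.<Topic>`
-- `Γ(Y, U)` versus `Y.presheaf.obj (op U)` inside `rw` motives and instance problems on the glued
-- scheme `R'.cobordantBlowup` (as in `…DatumToEmbedded.AtlasAmbientAssembly`):
set_option backward.isDefEq.respectTransparency false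

namespace Summit.ResolutionOfSingularities.ResolutionOfSingularities.Theorems.DatumToEmbedded.AtlasAmbient

/-! ## Transport, with the grading exposed -/

section Transport

variable {k : Type} [Field k] {Y X V : Scheme.{0}} (f : Y ⟶ Spec (.of k)) (i : X ⟶ Y)
  [IsClosedImmersion i] (q : X ⟶ V) {j : ℕ} (𝒜 : GradedAtlas j f i q) (R' : ReesFiltration Y)
  (a : 𝒜.ι)

-- adapted from Theorems/WeightedInvariantDatumToEmbeddedAtlasAmbientAssembly.lean (exists_ambientChart_of_chart)
/-- **Transport, tower-typed** (RESHAPE 10): the tree's `exists_ambientChart_of_chart` with the extra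
hypothesis "`x tⁿ ↦ (χ, n)`" on the grading `ℳ` of `L` and the extra conclusion that the chart built is a
`TowerChartStep` over `(W a, 𝒜.piece a)` — its grading is `e⁻¹ ℳ` by construction (`comapPiece`).
[cite: Wlodarczyk2022, §2.3.3] -/
theorem exists_ambientChart_of_chart_towerTyped [IsReduced X] {Dg : ℕ} {β : Γ(Y, 𝒜.W a)}
    (L : Type) [CommRing L] [Algebra (R'.sectionsRing (𝒜.W a)) L] (v₀ : R'.sectionsRing (𝒜.W a))
    [IsLocalization.Away v₀ L] (ℳ : (Fin j → ℤ) × ℤ → Submodule ℤ L) [GradedRing ℳ]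
    (ht : algebraMap (R'.sectionsRing (𝒜.W a)) L
      ⟨T (-1), (R'.filtration (𝒜.W a)).T_neg_one_mem_extendedRees⟩ ∈ ℳ ((0 : Fin j → ℤ), (-1 : ℤ)))
    (hv₀ : algebraMap (R'.sectionsRing (𝒜.W a)) L v₀ ∈ ℳ ((0 : Fin j → ℤ), (Dg : ℤ)))
    (hs : ∀ (χ : Fin j → ℤ) (s : Γ(Y, 𝒜.W a)), s ∈ 𝒜.piece a χ →
      algebraMap (R'.sectionsRing (𝒜.W a)) L (algebraMap Γ(Y, 𝒜.W a) (R'.sectionsRing (𝒜.W a)) s) ∈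
        ℳ (χ, (0 : ℤ)))
    (hmul : algebraMap (R'.sectionsRing (𝒜.W a)) L v₀ *
        algebraMap (R'.sectionsRing (𝒜.W a)) L
          ⟨T (-1), (R'.filtration (𝒜.W a)).T_neg_one_mem_extendedRees⟩ ^ Dg =
      algebraMap (R'.sectionsRing (𝒜.W a)) L (algebraMap Γ(Y, 𝒜.W a) (R'.sectionsRing (𝒜.W a)) β))
    (hex₁ : ∀ s ∈ ℳ 0, ∃ (l : ℕ) (x₀ : Γ(Y, 𝒜.W a)), x₀ ∈ (R'.ideal (Dg * l)).ideal (𝒜.W a) ∧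
      x₀ ∈ 𝒜.piece a 0 ∧
        s * algebraMap (R'.sectionsRing (𝒜.W a)) L v₀ ^ l *
            algebraMap (R'.sectionsRing (𝒜.W a)) L
              ⟨T (-1), (R'.filtration (𝒜.W a)).T_neg_one_mem_extendedRees⟩ ^ (Dg * l) =
          algebraMap (R'.sectionsRing (𝒜.W a)) L (algebraMap Γ(Y, 𝒜.W a) (R'.sectionsRing (𝒜.W a)) x₀))
    (hex₂ : ∀ (l : ℕ) (x₀ : Γ(Y, 𝒜.W a)), x₀ ∈ (R'.ideal (Dg * l)).ideal (𝒜.W a) →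
      x₀ ∈ 𝒜.piece a 0 → ∃ s ∈ ℳ 0,
        s * algebraMap (R'.sectionsRing (𝒜.W a)) L v₀ ^ l *
            algebraMap (R'.sectionsRing (𝒜.W a)) L
              ⟨T (-1), (R'.filtration (𝒜.W a)).T_neg_one_mem_extendedRees⟩ ^ (Dg * l) =
          algebraMap (R'.sectionsRing (𝒜.W a)) L (algebraMap Γ(Y, 𝒜.W a) (R'.sectionsRing (𝒜.W a)) x₀))
    (hcancel : ∀ (Lg : Type) [CommRing Lg] [Algebra (R'.sectionsRing (𝒜.W a)) Lg]
      (g : R'.sectionsRing (𝒜.W a)) [IsLocalization.Away g Lg] (u : Lg), IsUnit u →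
      u * algebraMap (R'.sectionsRing (𝒜.W a)) Lg
          ⟨T (-1), (R'.filtration (𝒜.W a)).T_neg_one_mem_extendedRees⟩ ^ Dg =
        algebraMap (R'.sectionsRing (𝒜.W a)) Lg
          (algebraMap Γ(Y, 𝒜.W a) (R'.sectionsRing (𝒜.W a)) β) →
      IsUnit (algebraMap (R'.sectionsRing (𝒜.W a)) Lg v₀))
    (hcontr : ∀ (x : Γ(Y, 𝒜.W a)) (n : ℕ),
      algebraMap (R'.sectionsRing (𝒜.W a)) L
            ⟨T (-1), (R'.filtration (𝒜.W a)).T_neg_one_mem_extendedRees⟩ ^ n *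
          algebraMap (R'.sectionsRing (𝒜.W a)) L
            (algebraMap Γ(Y, 𝒜.W a) (R'.sectionsRing (𝒜.W a)) x) ∈
        ((i.ker.ideal (𝒜.W a)).map (algebraMap Γ(Y, 𝒜.W a) (R'.sectionsRing (𝒜.W a)))).map
          (algebraMap (R'.sectionsRing (𝒜.W a)) L) →
      ∃ M : ℕ, x * β ^ M ∈ i.ker.ideal (𝒜.W a))
    (hhomog : (⨆ n : ℕ, ((i.ker.ideal (𝒜.W a)).map ((algebraMap (R'.sectionsRing (𝒜.W a)) L).comp
        (algebraMap Γ(Y, 𝒜.W a) (R'.sectionsRing (𝒜.W a))))).colon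
        ((Ideal.span {algebraMap (R'.sectionsRing (𝒜.W a)) L
          ⟨T (-1), (R'.filtration (𝒜.W a)).T_neg_one_mem_extendedRees⟩} ^ n : Ideal L) :
            Set L)).IsHomogeneous ℳ)
    (hxT : ∀ (χ : Fin j → ℤ) (n : ℕ) (x : Γ(Y, 𝒜.W a)) (hx : x ∈ (R'.ideal n).ideal (𝒜.W a)),
      x ∈ 𝒜.piece a χ → algebraMap (R'.sectionsRing (𝒜.W a)) L
        ⟨C x * T (n : ℤ), (R'.filtration (𝒜.W a)).C_mul_T_mem_extendedRees_iff.mpr hx⟩ ∈ ℳ (χ, (n : ℤ)))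
    (W' : (R'.plus : Scheme.{0}).affineOpens)
    (hW' : (W' : (R'.plus : Scheme.{0}).Opens) ≤ R'.πPlus ⁻¹ᵁ (𝒜.W a : Y.Opens))
    (e : Γ((R'.plus : Scheme.{0}), W') ≃+* L)
    (he₁ : ∀ s : Γ(Y, 𝒜.W a), e (R'.πPlus.appLE (𝒜.W a) W' hW' s) =
      algebraMap (R'.sectionsRing (𝒜.W a)) L (algebraMap Γ(Y, 𝒜.W a) (R'.sectionsRing (𝒜.W a)) s))
    (he₂ : e (tInvOn R' W') = algebraMap (R'.sectionsRing (𝒜.W a)) L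
      ⟨T (-1), (R'.filtration (𝒜.W a)).T_neg_one_mem_extendedRees⟩)
    (he₃ : (R'.strictTransformPlus i.ker).ideal W' =
      (⨆ n : ℕ, ((i.ker.ideal (𝒜.W a)).map ((algebraMap (R'.sectionsRing (𝒜.W a)) L).comp
        (algebraMap Γ(Y, 𝒜.W a) (R'.sectionsRing (𝒜.W a))))).colon
        ((Ideal.span {algebraMap (R'.sectionsRing (𝒜.W a)) L
          ⟨T (-1), (R'.filtration (𝒜.W a)).T_neg_one_mem_extendedRees⟩} ^ n : Ideal L) :
            Set L)).comap e.toRingHom)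
    (he₄ : ∀ (y' : (R'.plus : Scheme.{0}))
      (q₀ : Spec (CommRingCat.of (R'.sectionsRing (𝒜.W a)))),
      R'.openCover.f ⟨(𝒜.W a).1, (𝒜.W a).2⟩ q₀ = y'.1 → v₀ ∉ q₀.asIdeal →
        y' ∈ (W' : (R'.plus : Scheme.{0}).Opens)) :
    ∃ 𝒞 : AmbientChart j f i q 𝒜 R'.ideal R' Dg a β,
      (∀ x : Γ(Y, 𝒜.W a), R'.πPlus.appLE (𝒜.W a) 𝒞.W' 𝒞.le_preimage x ∈
        (R'.strictTransformPlus i.ker).ideal 𝒞.W' → x * β ∈ i.ker.ideal (𝒜.W a)) ∧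
      TowerChartStep (𝒜.W a) j (𝒜.piece a) R' 𝒞.W' 𝒞.piece := by
  classical
  -- the re-indexing `ℤʲ⁺¹ ≃ ℤʲ × ℤ`, `v ↦ (init v, v last)`, inverse `Fin.snoc`
  let g : (Fin (j + 1) → ℤ) ≃+ (Fin j → ℤ) × ℤ :=
    { toFun := fun v => (Fin.init v, v (Fin.last j))
      invFun := fun c => Fin.snoc c.1 c.2
      left_inv := fun v => Fin.snoc_init_self (α := fun _ => ℤ) v
      right_inv := fun c =>
        Prod.ext (Fin.init_snoc (α := fun _ => ℤ) c.2 c.1) (Fin.snoc_last (α := fun _ => ℤ) c.2 c.1)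
      map_add' := fun _ _ => rfl }
  have hg : ∀ (χ : Fin j → ℤ) (n : ℤ), g (Fin.snoc (α := fun _ => ℤ) χ n) = (χ, n) :=
    fun χ n => Prod.ext (Fin.init_snoc (α := fun _ => ℤ) n χ) (Fin.snoc_last (α := fun _ => ℤ) n χ)
  -- the transported grading
  obtain ⟨instC⟩ := nonempty_gradedRing_comapPiece e ℳ g
  let piece : (Fin (j + 1) → ℤ) → AddSubgroup Γ((R'.plus : Scheme.{0}), W') :=
    fun v => (comapPiece e ℳ g v).toAddSubgroup
  have hpiece : ∀ v x, x ∈ piece v ↔ e x ∈ ℳ (g v) := fun _ _ => Iff.rfl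
  obtain ⟨instP⟩ := QuotientSingularities.nonempty_gradedRing_of_mem_iff (comapPiece e ℳ g) piece
    (fun _ _ => Iff.rfl)
  -- the graded structure map and the unit `η`
  have happ : ∀ (χ : Fin j → ℤ) (s : Γ(Y, 𝒜.W a)), s ∈ 𝒜.piece a χ →
      R'.πPlus.appLE (𝒜.W a) W' hW' s ∈ piece (Fin.snoc (α := fun _ => ℤ) χ 0) := by
    intro χ s hs'
    rw [hpiece, hg, he₁]
    exact hs χ s hs'
  have hηmul : e.symm (algebraMap (R'.sectionsRing (𝒜.W a)) L v₀) * tInvOn R' W' ^ Dg =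
      R'.πPlus.appLE (𝒜.W a) W' hW' β :=
    e.injective (by rw [map_mul, map_pow, RingEquiv.apply_symm_apply, he₂, he₁, hmul])
  have hisUnit : IsUnit (e.symm (algebraMap (R'.sectionsRing (𝒜.W a)) L v₀)) :=
    (IsLocalization.Away.algebraMap_isUnit v₀).map e.symm
  refine ⟨{ W' := W'
            le_preimage := hW'
            piece := piece
            gradedRing := instP
            η := e.symm (algebraMap (R'.sectionsRing (𝒜.W a)) L v₀)
            isUnit_η := hisUnit
            η_mem := by
              rw [hpiece, hg, RingEquiv.apply_symm_apply]
              exact hv₀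
            tInvOn_mem := by
              rw [hpiece, hg, he₂]
              exact ht
            η_mul := hηmul
            appLE_mem := happ
            const_mem := ?_
            isHomogeneous := ?_
            mem_iff := ?_
            exists_of_mem_zero := ?_
            exists_mem_zero := ?_ }, ?_, ?_⟩
  · -- constants have degree `0`
    intro c
    have hc : (R'.πPlus ≫ f).appLE ⊤ W' le_top c =
        R'.πPlus.appLE (𝒜.W a) W' hW' (f.appLE ⊤ (𝒜.W a) le_top c) := by
      rw [← Scheme.Hom.appLE_comp_appLE R'.πPlus f ⊤ (𝒜.W a) W' le_top hW']
      rfl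
    refine (hpiece 0 _).2 ?_
    rw [map_zero, hc, he₁]
    exact hs 0 _ (𝒜.appLE_mem a c)
  · -- the strict transform's ideal is homogeneous
    rw [he₃]
    exact isHomogeneous_of_mem_iff (comapPiece e ℳ g) piece (fun _ _ => Iff.rfl)
      (isHomogeneous_comap e ℳ g hhomog)
  · -- `W'` is the locus where `σ₊♯β = (t⁻¹)^{Dg} · unit`
    intro y'
    constructor
    · intro hy'
      exact ⟨W', hW', hy', _, hisUnit, hηmul⟩
    · rintro ⟨O, hO, hy'O, η₀, hη₀, heq⟩
      obtain ⟨q₀, -, hq₀⟩ := Exceptional.exists_mem_plusChart R' y'.1 y'.2 (𝒜.W a)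
        (π_apply_mem R' (𝒜.W a) y' O hO hy'O)
      exact he₄ y' q₀ hq₀
        (not_mem_of_isUnit R' (𝒜.W a) v₀ β hcancel y' O hO hy'O η₀ hη₀ heq q₀ hq₀)
  · -- degree-`(0,0)` sections
    intro s hs'
    have hs0 : e s ∈ ℳ 0 := by
      have h := (hpiece 0 s).1 hs'
      rwa [map_zero] at h
    obtain ⟨l, x₀, hx₀J, hx₀0, hx⟩ := hex₁ (e s) hs0
    refine ⟨l, x₀, hx₀J, hx₀0, e.injective ?_⟩
    rw [map_mul, map_mul, map_pow, map_pow, RingEquiv.apply_symm_apply, he₂, he₁, hx]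
  · -- … and conversely
    intro l x₀ hx₀J hx₀0
    obtain ⟨s, hs0, hx⟩ := hex₂ l x₀ hx₀J hx₀0
    refine ⟨e.symm s, ?_, e.injective ?_⟩
    · rw [hpiece, map_zero, RingEquiv.apply_symm_apply]
      exact hs0
    · rw [map_mul, map_mul, map_pow, map_pow, RingEquiv.apply_symm_apply,
        RingEquiv.apply_symm_apply, he₂, he₁, hx]
  · -- the contraction property
    intro x hx
    change R'.πPlus.appLE (𝒜.W a) W' hW' x ∈ (R'.strictTransformPlus i.ker).ideal W' at hx
    rw [he₃, Ideal.mem_comap, RingEquiv.toRingHom_eq_coe, RingHom.coe_coe, he₁,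
      StrictTransform.mem_iSup_colon_span_singleton_pow_iff] at hx
    obtain ⟨n, hn⟩ := hx
    rw [← Ideal.map_map] at hn
    obtain ⟨M, hM⟩ := hcontr x n hn
    exact mul_mem_ker_ideal_of_mul_pow_mem i (𝒜.W a) hM
  · -- the chart is a TOWER chart over `(W a, 𝒜.piece a)` (RESHAPE 10: the grading exposed)
    exact ⟨hW', L, inferInstance, inferInstance, v₀, inferInstance, e, ℳ, inferInstance, he₁, he₂, ht, hs,
      hxT, fun v y => hpiece v y⟩

end Transport

/-! ## The chart `D(β t^{Dg})`, tower-typed -/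

section Chart

variable {k : Type} [Field k] {Y X V : Scheme.{0}} (f : Y ⟶ Spec (.of k)) (i : X ⟶ Y)
  [IsClosedImmersion i] (q : X ⟶ V) {j : ℕ} (𝒜 : GradedAtlas j f i q) (R' : ReesFiltration Y)

-- adapted from Theorems/WeightedInvariantDatumToEmbeddedAtlasAmbientAssembly.lean (exists_ambientChart)
/-- **The ambient chart `D(β t^{Dg})` of the rank-`j+1` atlas IS A TOWER CHART** (RESHAPE 10): the tree's
`exists_ambientChart` — for a Rees filtration whose pieces are homogeneous on the chart `W a`, a degree
`Dg > 0` and a degree-`0` section `β ∈ 𝒥_Dg(W a)` (`B` locally Noetherian, `X` reduced), a term of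
`AmbientChart` with the contraction property — together with `TowerChartStep (W a) j (𝒜.piece a) R' W' piece`:
the grading of the chart is (old `ℤʲ`-degree, `t`-degree) on `(⊕ₙ 𝒥ₙ(W a) tⁿ)[1/β t^{Dg}]`.
[cite: Wlodarczyk2022, §2.3.3] -/
theorem exists_ambientChart_towerTyped [IsReduced X] [IsLocallyNoetherian R'.cobordantBlowup]
    {J : ℕ → Y.IdealSheafData} (hR' : R'.ideal = J) (a : 𝒜.ι)
    (hhom : ∀ n : ℕ, @Ideal.IsHomogeneous (Fin j → ℤ) (AddSubgroup Γ(Y, 𝒜.W a)) Γ(Y, 𝒜.W a) _ _ _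
      (𝒜.piece a) _ _ (𝒜.gradedRing a) ((J n).ideal (𝒜.W a)))
    {Dg : ℕ} (hDg : 0 < Dg) {β : Γ(Y, 𝒜.W a)} (hβJ : β ∈ (J Dg).ideal (𝒜.W a))
    (hβ0 : β ∈ 𝒜.piece a 0) :
    ∃ 𝒞 : AmbientChart j f i q 𝒜 J R' Dg a β,
      (∀ x : Γ(Y, 𝒜.W a), R'.πPlus.appLE (𝒜.W a) 𝒞.W' 𝒞.le_preimage x ∈
        (R'.strictTransformPlus i.ker).ideal 𝒞.W' → x * β ∈ i.ker.ideal (𝒜.W a)) ∧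
      TowerChartStep (𝒜.W a) j (𝒜.piece a) R' 𝒞.W' 𝒞.piece := by
  subst hR'
  classical
  letI := 𝒜.gradedRing a
  -- the `ℤʲ`-grading of `Γ(Y, W a)` by `ℤ`-submodules, of `Γ(Y, W a)[t, t⁻¹]` by `ℤʲ × ℤ`, and of
  -- the extended Rees algebra (the pieces `𝒥ₙ(W a)` are homogeneous)
  let 𝒜₀ : (Fin j → ℤ) → Submodule ℤ Γ(Y, 𝒜.W a) := fun χ => AddSubgroup.toIntSubmodule (𝒜.piece a χ)
  have h𝒜₀ : ∀ χ x, x ∈ 𝒜₀ χ ↔ x ∈ 𝒜.piece a χ := fun _ _ => Iff.rfl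
  obtain ⟨inst₀⟩ := QuotientSingularities.nonempty_gradedRing_of_mem_iff (𝒜.piece a) 𝒜₀ h𝒜₀
  obtain ⟨inst₁⟩ := nonempty_gradedRing_laurentPiece 𝒜₀
  have hF : ∀ n, ((R'.filtration (𝒜.W a)).ideal n).IsHomogeneous 𝒜₀ := fun n =>
    isHomogeneous_of_mem_iff (𝒜.piece a) 𝒜₀ h𝒜₀ (hhom n)
  obtain ⟨inst₂⟩ := nonempty_gradedRing_subalgebraPiece (laurentPiece 𝒜₀)
    (R'.filtration (𝒜.W a)).extendedRees
    (fun x hx κ => decompose_mem_extendedRees 𝒜₀ (R'.filtration (𝒜.W a)) hF hx κ)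
  -- `v₀ = β t^{Dg}`, homogeneous of degree `(0, Dg)`, in the irrelevant ideal
  let v₀ : R'.sectionsRing (𝒜.W a) :=
    ⟨C β * T (Dg : ℤ), (R'.filtration (𝒜.W a)).C_mul_T_mem_extendedRees_iff.mpr hβJ⟩
  have hv : (v₀ : (Γ(Y, 𝒜.W a))[T;T⁻¹]) = C β * T (Dg : ℤ) := rfl
  have hv₀ : v₀ ∈ subalgebraPiece (laurentPiece 𝒜₀) (R'.filtration (𝒜.W a)).extendedRees
      ((0 : Fin j → ℤ), (Dg : ℤ)) :=
    mem_subalgebraPiece_of_coe_eq 𝒜₀ _ ((h𝒜₀ 0 β).2 hβ0) _ v₀ rfl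
  have hirr : v₀ ∈ (R'.filtration (𝒜.W a)).irrelevant := Ideal.subset_span ⟨Dg, β, hDg, hβJ, rfl⟩
  obtain ⟨inst₃⟩ := nonempty_gradedRing_awayPiece
    (subalgebraPiece (laurentPiece 𝒜₀) (R'.filtration (𝒜.W a)).extendedRees) hv₀ (Localization.Away v₀)
  -- the chart `D(v₀)` of `B₊` and the transport
  obtain ⟨W', hW', e, he₁, he₂, he₃, he₄⟩ :=
    exists_chart R' (𝒜.W a) (Localization.Away v₀) v₀ hirr
  exact exists_ambientChart_of_chart_towerTyped f i q 𝒜 R' a (Localization.Away v₀) v₀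
    (awayPiece (subalgebraPiece (laurentPiece 𝒜₀) (R'.filtration (𝒜.W a)).extendedRees) hv₀
      (Localization.Away v₀))
    (algebraMap_t_mem_awayPiece 𝒜₀ _ _ hv₀) (algebraMap_self_mem_awayPiece 𝒜₀ _ _ hv₀)
    (fun χ s hs => algebraMap_algebraMap_mem_awayPiece 𝒜₀ _ _ hv₀ ((h𝒜₀ χ s).2 hs))
    (algebraMap_mul_t_pow _ _ hv)
    (fun s hs => by
      obtain ⟨l, x₀, h1, h2, h3⟩ := exists_of_mem_awayPiece_zero 𝒜₀ _ _ hv₀ hs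
      exact ⟨l, x₀, h1, (h𝒜₀ 0 x₀).1 h2, h3⟩)
    (fun l x₀ h1 h2 => exists_mem_awayPiece_zero 𝒜₀ _ _ hv₀ l h1 ((h𝒜₀ 0 x₀).2 h2))
    (fun Lg _ _ g _ u hu h => isUnit_algebraMap_of_mul_t_pow_eq _ hv Lg g hu h)
    (fun x n h => exists_mul_pow_mem _ _ hv h)
    (isHomogeneous_iSup_colon_map 𝒜₀ _ _ hv₀
      (isHomogeneous_of_mem_iff (𝒜.piece a) 𝒜₀ h𝒜₀ (𝒜.isHomogeneous_ker a)))
    (fun χ n x hx hxχ => algebraMap_mem_awayPiece hv₀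
      (mem_subalgebraPiece_of_coe_eq 𝒜₀ _ ((h𝒜₀ χ x).2 hxχ) (n : ℤ) _ rfl))
    W' hW' e he₁ he₂ (he₃ i.ker) he₄

/-! ## Registered form -/

/-- **Registered form `hyp_exists_ambientChart_towerTyped`** of `exists_ambientChart_towerTyped` (registered
stub of line `datum-glued-split`, RESHAPE 10, on crux stmt-0569): the ambient chart `D(β t^{Dg})` of the
rank-`j+1` atlas on the cobordant blow-up is a TOWER chart over `(W a, 𝒜.piece a)`.
[cite: Wlodarczyk2022, §2.3.3] -/
theorem hyp_exists_ambientChart_towerTyped : ∀ {k : Type} [Field k] {Y X V : AlgebraicGeometry.Scheme.{0}} (f : Y ⟶ AlgebraicGeometry.Spec (.of k)) (i : X ⟶ Y) [AlgebraicGeometry.IsClosedImmersion i] (q : X ⟶ V) {j : ℕ} (𝒜 : Summit.ResolutionOfSingularities.ResolutionOfSingularities.Theorems.GradedAtlas j f i q) (R' : Literature.AlgebraicGeometry.Resolution.ReesFiltration Y) [AlgebraicGeometry.IsReduced X] [AlgebraicGeometry.IsLocallyNoetherian R'.cobordantBlowup] (a : 𝒜.ι), (∀ n : ℕ, @Ideal.IsHomogeneous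 (Fin j → ℤ) (AddSubgroup Γ(Y, 𝒜.W a)) Γ(Y, 𝒜.W a) _ _ _ (𝒜.piece a) _ _ (𝒜.gradedRing a) ((R'.ideal n).ideal (𝒜.W a))) → ∀ {Dg : ℕ}, 0 < Dg → ∀ {β : Γ(Y, 𝒜.W a)}, β ∈ (R'.ideal Dg).ideal (𝒜.W a) → β ∈ 𝒜.piece a 0 → ∃ 𝒞 : Summit.ResolutionOfSingularities.ResolutionOfSingularities.Theorems.AmbientChart j f i q 𝒜 R'.ideal R' Dg a β, (∀ x : Γ(Y, 𝒜.W a), R'.πPlus.appLE (𝒜.W a) 𝒞.W' 𝒞.le_preimage x ∈ (R'.strictTransformPlus i.ker).ideal 𝒞.W' → x * β ∈ i.ker.ideal (𝒜.W a)) ∧ Summit.ResolutionOfSingularities.ResolutionOfSingularities.Theorems.TowerChartStep (𝒜.W a) j (𝒜.piece a) R' 𝒞.W' 𝒞.piece := by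
  intro k _ Y X V f i _ q j 𝒜 R' _ _ a hhom Dg hDg β hβJ hβ0
  exact exists_ambientChart_towerTyped f i q 𝒜 R' rfl a hhom hDg hβJ hβ0

end Chart

end Summit.ResolutionOfSingularities.ResolutionOfSingularities.Theorems.DatumToEmbedded.AtlasAmbient

end
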